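import Mathlib
import HarnessLib
import Literature.Analysis.FunctionSpaces.TestPairingLimits
import Literature.Analysis.FunctionSpaces.WeakL3Compactness
import Literature.Analysis.FluidPDE.SteadyNSCaccioppoliTools
import Summits.NavierStokesRegularity.NavierStokesRegularity.Theorems.QuarterLogPincerTypeIQuantSubcubicExpZoomTrace

/-!
# Crux `QuarterLogPincer.TypeIQuantSubcubicExp` (stmt-NavierStokesRegularity-24077), line `thin_cascade`:
  clause (6) of `ThinObject` — the annular cube budget passes to the weak trace

Helper file (`--supports stmt-NavierStokesRegularity-24077 --as helper`, lead prover ns-tc-p1 g3) toward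
the registered stub `stub_thinObjectExtraction` (S2, skeleton v5), trace block.  Lower semicontinuity
of the `L³` norm on an open annulus under weak convergence tested against compactly supported `L²`
fields, by duality (`memLp_three_of_forall_abs_integral_inner_le` of the tree's `TestPairingLimits`,
Hölder `L³ × L^{3/2}`):

* `lintegral_annulus_cube_le_of_weak` — if continuous fields `V k` with
  `∫_{1<|y|<e^m} |V k|³ ≤ B` (eventually) converge weakly to a locally square-integrable `g`, then
  `∫_{1<|y|<e^m} |g|³ ≤ B`;
* `annulus_budget_of_weak` — with the budgets `q·j` on `1 < |y| < e^j` for all `j` (eventually in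
  `k`): `∫_{1<|y|<R} |g|³ ≤ q (1 + log R)` for every `R ≥ 1` — clause (6) of `ThinObject`.

HONEST FRAMING: bookkeeping toward one registered stub of an open crux; nothing about Navier–Stokes
regularity is proved; no summit statement is proved by this file.
-/

noncomputable section

-- the summit-side namespace `Summit.NavierStokesRegularity.NavierStokesRegularity.…` (single-conjunct summit,
-- D-0017) repeats a component by design; the dupNamespace linter would flag every declaration.
set_option linter.dupNamespace false

namespace Summit.NavierStokesRegularity.NavierStokesRegularity.Theorems.ThinCascade

open MeasureTheory Set Function Metric Filter Topology
open scoped ENNReal NNReal InnerProductSpace RealInnerProductSpace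
open Literature.Analysis Literature.Analysis.FluidPDE Literature.Analysis.FunctionSpaces

/-- The open annulus `1 < |y| < b` is measurable and bounded. [folklore] -/
theorem measurableSet_annulus (b : ℝ) :
    MeasurableSet {y : EuclideanSpace ℝ (Fin 3) | 1 < ‖y‖ ∧ ‖y‖ < b} := by
  rw [setOf_and]
  exact (measurableSet_lt measurable_const continuous_norm.measurable).inter
    (measurableSet_lt continuous_norm.measurable measurable_const)

/-- **Lower semicontinuity of the annular cube under weak convergence.**  Let `V k : ℝ³ → ℝ³` be
continuous with `∫_{1<|y|<b} |V k|³ ≤ B` for all large `k`, and let `g` be a.e.-strongly measurable,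
square integrable on balls, with `∫⟪V k, ζ⟫ → ∫⟪g, ζ⟫` for every `ζ ∈ L²` vanishing off a ball.
Then `∫_{1<|y|<b} |g|³ ≤ B` (duality `L³ = (L^{3/2})*` on test fields and Hölder along the
sequence). [folklore] -/
theorem lintegral_annulus_cube_le_of_weak
    {V : ℕ → EuclideanSpace ℝ (Fin 3) → EuclideanSpace ℝ (Fin 3)}
    {g : EuclideanSpace ℝ (Fin 3) → EuclideanSpace ℝ (Fin 3)} (hVc : ∀ k, Continuous (V k))
    (hgm : AEStronglyMeasurable g volume)
    (hg2 : ∀ a : ℝ, IntegrableOn (fun y => ‖g y‖ ^ 2) (ball (0 : EuclideanSpace ℝ (Fin 3)) a) volume)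
    (hweak : ∀ (ζ : EuclideanSpace ℝ (Fin 3) → EuclideanSpace ℝ (Fin 3)), MemLp ζ 2 volume →
      ∀ (a : ℝ), (∀ y, y ∉ ball (0 : EuclideanSpace ℝ (Fin 3)) a → ζ y = 0) →
      Tendsto (fun k => ∫ y, ⟪V k y, ζ y⟫) atTop (𝓝 (∫ y, ⟪g y, ζ y⟫)))
    {b B : ℝ} (hB : 0 ≤ B)
    (hbudget : ∀ᶠ k in atTop,
      ∫⁻ y in {y : EuclideanSpace ℝ (Fin 3) | 1 < ‖y‖ ∧ ‖y‖ < b}, ENNReal.ofReal (‖V k y‖ ^ 3) ≤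
        ENNReal.ofReal B) :
    ∫⁻ y in {y : EuclideanSpace ℝ (Fin 3) | 1 < ‖y‖ ∧ ‖y‖ < b}, ENNReal.ofReal (‖g y‖ ^ 3) ≤
      ENNReal.ofReal B := by
  set A : Set (EuclideanSpace ℝ (Fin 3)) := {y | 1 < ‖y‖ ∧ ‖y‖ < b} with hA
  have hAm : MeasurableSet A := measurableSet_annulus b
  have hAball : A ⊆ ball (0 : EuclideanSpace ℝ (Fin 3)) b := fun y hy => by
    rw [mem_ball_zero_iff]; exact hy.2
  have hAbdd : Bornology.IsBounded A := isBounded_ball.subset hAball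
  -- cubes as `L³` norms of indicators
  have hcube : ∀ f : EuclideanSpace ℝ (Fin 3) → EuclideanSpace ℝ (Fin 3),
      ∫⁻ y in A, ENNReal.ofReal (‖f y‖ ^ 3) = eLpNorm (A.indicator f) 3 volume ^ (3 : ℕ) := by
    intro f
    rw [eLpNorm_indicator_eq_eLpNorm_restrict hAm,
      eLpNorm_eq_lintegral_rpow_enorm_toReal (by norm_num) (by norm_num), ENNReal.toReal_ofNat,
      ← ENNReal.rpow_natCast, ← ENNReal.rpow_mul, show (1 / (3 : ℝ) * ((3 : ℕ) : ℝ)) = 1 by norm_num,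
      ENNReal.rpow_one]
    refine lintegral_congr fun y => ?_
    rw [ENNReal.ofReal_pow (norm_nonneg _), ofReal_norm, show (3 : ℝ) = ((3 : ℕ) : ℝ) by norm_num,
      ENNReal.rpow_natCast]
  -- the bound on the sequence as an `L³` bound of the indicators
  have hVk3 : ∀ k, MemLp (A.indicator (V k)) 3 volume := fun k =>
    (memLp_indicator_iff_restrict hAm).2 (memLp_restrict_of_continuous_isBounded (hVc k) hAbdd 3)
  have hVnorm : ∀ᶠ k in atTop, eLpNorm (A.indicator (V k)) 3 volume ≤ ENNReal.ofReal (B ^ (1 / 3 : ℝ)) := by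
    filter_upwards [hbudget] with k hk
    rw [hcube] at hk
    have h := ENNReal.rpow_le_rpow hk (by norm_num : (0 : ℝ) ≤ 1 / 3)
    rwa [← ENNReal.rpow_natCast, ← ENNReal.rpow_mul, show (((3 : ℕ) : ℝ) * (1 / 3)) = 1 by norm_num,
      ENNReal.rpow_one, ENNReal.ofReal_rpow_of_nonneg hB (by norm_num)] at h
  -- the indicator of the limit
  set G : EuclideanSpace ℝ (Fin 3) → EuclideanSpace ℝ (Fin 3) := A.indicator g with hG
  have hGm : AEStronglyMeasurable G volume := hgm.indicator hAm
  have hG2 : LocallyIntegrable (fun y => ‖G y‖ ^ 2) volume := by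
    have hint : Integrable (fun y => ‖G y‖ ^ 2) volume := by
      have e : (fun y => ‖G y‖ ^ 2) = A.indicator fun y => ‖g y‖ ^ 2 := by
        funext y
        simp only [hG]
        by_cases hy : y ∈ A
        · rw [indicator_of_mem hy, indicator_of_mem hy]
        · rw [indicator_of_notMem hy, indicator_of_notMem hy, norm_zero, zero_pow two_ne_zero]
      rw [e, integrable_indicator_iff hAm]
      exact (hg2 b).mono_set hAball
    exact hint.locallyIntegrable
  -- duality bound for the indicator of the limit
  have hdual : ∀ φ : EuclideanSpace ℝ (Fin 3) → EuclideanSpace ℝ (Fin 3),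
      IsTestFunctionOn (⊤ : TopologicalSpace.Opens (EuclideanSpace ℝ (Fin 3))) φ →
      |∫ y, ⟪G y, φ y⟫| ≤ B ^ (1 / 3 : ℝ) * (eLpNorm φ (3 / 2 : ℝ≥0∞) volume).toReal := by
    intro φ hφ
    set ζ : EuclideanSpace ℝ (Fin 3) → EuclideanSpace ℝ (Fin 3) := A.indicator φ with hζ
    have hφc : Continuous φ := hφ.contDiff.continuous
    have hφ2 : MemLp φ 2 volume := hφc.memLp_of_hasCompactSupport hφ.hasCompactSupport
    have hφ32 : MemLp φ (3 / 2 : ℝ≥0∞) volume := hφc.memLp_of_hasCompactSupport hφ.hasCompactSupport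
    have hζ2 : MemLp ζ 2 volume := hφ2.indicator hAm
    have hζsupp : ∀ y, y ∉ ball (0 : EuclideanSpace ℝ (Fin 3)) b → ζ y = 0 := fun y hy => by
      simp only [hζ]; exact indicator_of_notMem (fun h => hy (hAball h)) _
    -- `⟪G, φ⟫ = ⟪g, ζ⟫` and `⟪V k, ζ⟫ = ⟪1_A V k, φ⟫` pointwise
    have e1 : ∀ y, ⟪G y, φ y⟫ = ⟪g y, ζ y⟫ := fun y => by
      simp only [hG, hζ]
      by_cases hy : y ∈ A
      · rw [indicator_of_mem hy, indicator_of_mem hy]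
      · rw [indicator_of_notMem hy, indicator_of_notMem hy, inner_zero_left, inner_zero_right]
    have e2 : ∀ k y, ⟪V k y, ζ y⟫ = ⟪A.indicator (V k) y, φ y⟫ := fun k y => by
      simp only [hζ]
      by_cases hy : y ∈ A
      · rw [indicator_of_mem hy, indicator_of_mem hy]
      · rw [indicator_of_notMem hy, indicator_of_notMem hy, inner_zero_left, inner_zero_right]
    have hlim : Tendsto (fun k => ∫ y, ⟪A.indicator (V k) y, φ y⟫) atTop (𝓝 (∫ y, ⟪G y, φ y⟫)) := by
      have h := hweak ζ hζ2 b hζsupp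
      simp_rw [e2] at h
      simp_rw [e1]
      exact h
    -- Hölder along the sequence
    have hζ32 : eLpNorm ζ (3 / 2 : ℝ≥0∞) volume ≤ eLpNorm φ (3 / 2 : ℝ≥0∞) volume := by
      rw [hζ]; exact eLpNorm_indicator_le φ
    have hbd : ∀ᶠ k in atTop, |∫ y, ⟪A.indicator (V k) y, φ y⟫| ≤
        B ^ (1 / 3 : ℝ) * (eLpNorm φ (3 / 2 : ℝ≥0∞) volume).toReal := by
      filter_upwards [hVnorm] with k hk
      refine (abs_integral_inner_le_eLpNorm_three_mul_threeHalves (hVk3 k) hφ32).trans ?_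
      refine mul_le_mul_of_nonneg_right ?_ ENNReal.toReal_nonneg
      have := ENNReal.toReal_mono ENNReal.ofReal_ne_top hk
      rwa [ENNReal.toReal_ofReal (by positivity)] at this
    exact le_of_tendsto ((continuous_abs.tendsto _).comp hlim) hbd
  obtain ⟨-, hG3⟩ := memLp_three_of_forall_abs_integral_inner_le hGm hG2 (by positivity) hdual
  -- back to the cube
  rw [hcube g]
  calc eLpNorm (A.indicator g) 3 volume ^ (3 : ℕ) ≤ ENNReal.ofReal (B ^ (1 / 3 : ℝ)) ^ (3 : ℕ) :=
      pow_le_pow_left' hG3 3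
    _ = ENNReal.ofReal B := by
        rw [← ENNReal.ofReal_pow (by positivity), ← Real.rpow_natCast,
          ← Real.rpow_mul hB, show ((1 / 3 : ℝ) * ((3 : ℕ) : ℝ)) = 1 by norm_num, Real.rpow_one]

/-- **Clause (6) of `ThinObject` for the weak trace.**  If continuous fields `V k` obey the
annular budgets `∫_{1<|y|<e^j} |V k|³ ≤ q j` for every `j ≥ 1` and all large `k` (depending on `j`),
`q ≥ 0`, and converge weakly (against compactly supported `L²` fields) to `g` (a.e.-strongly
measurable, square integrable on balls), then for every `R ≥ 1`
`∫_{1<|x|<R} |g|³ ≤ q (1 + log R)` (take `j = ⌈log R⌉`). [folklore] -/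
theorem annulus_budget_of_weak
    {V : ℕ → EuclideanSpace ℝ (Fin 3) → EuclideanSpace ℝ (Fin 3)}
    {g : EuclideanSpace ℝ (Fin 3) → EuclideanSpace ℝ (Fin 3)} (hVc : ∀ k, Continuous (V k))
    (hgm : AEStronglyMeasurable g volume)
    (hg2 : ∀ a : ℝ, IntegrableOn (fun y => ‖g y‖ ^ 2) (ball (0 : EuclideanSpace ℝ (Fin 3)) a) volume)
    (hweak : ∀ (ζ : EuclideanSpace ℝ (Fin 3) → EuclideanSpace ℝ (Fin 3)), MemLp ζ 2 volume →
      ∀ (a : ℝ), (∀ y, y ∉ ball (0 : EuclideanSpace ℝ (Fin 3)) a → ζ y = 0) →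
      Tendsto (fun k => ∫ y, ⟪V k y, ζ y⟫) atTop (𝓝 (∫ y, ⟪g y, ζ y⟫)))
    {q : ℝ} (hq : 0 ≤ q)
    (hbudget : ∀ j : ℕ, 1 ≤ j → ∀ᶠ k in atTop,
      ∫⁻ y in {y : EuclideanSpace ℝ (Fin 3) | 1 < ‖y‖ ∧ ‖y‖ < Real.exp j}, ENNReal.ofReal (‖V k y‖ ^ 3) ≤
        ENNReal.ofReal (q * j)) :
    ∀ R : ℝ, 1 ≤ R →
      ∫⁻ x in {x : EuclideanSpace ℝ (Fin 3) | 1 < ‖x‖ ∧ ‖x‖ < R}, ENNReal.ofReal (‖g x‖ ^ 3) ≤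
        ENNReal.ofReal (q * (1 + Real.log R)) := by
  intro R hR
  have hlog : 0 ≤ Real.log R := Real.log_nonneg hR
  set j : ℕ := ⌈Real.log R⌉₊ with hj
  rcases Nat.eq_zero_or_pos j with hj0 | hjpos
  · -- `log R = 0`, i.e. `R = 1`: the annulus is empty
    have hlog0 : Real.log R ≤ 0 := by
      have := Nat.ceil_eq_zero.1 hj0
      exact this
    have hR1 : R = 1 := le_antisymm (by
      by_contra h
      push Not at h
      exact absurd (Real.log_pos h) (not_lt.2 hlog0)) hR
    have hempty : {x : EuclideanSpace ℝ (Fin 3) | 1 < ‖x‖ ∧ ‖x‖ < R} = ∅ := by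
      ext x; simp only [mem_setOf_eq, mem_empty_iff_false, iff_false, not_and, not_lt, hR1]
      exact fun h => h.le
    rw [hempty, Measure.restrict_empty, lintegral_zero_measure]
    exact bot_le
  · have hjR : R ≤ Real.exp j := by
      have h1 : Real.log R ≤ j := Nat.le_ceil _
      calc R = Real.exp (Real.log R) := (Real.exp_log (by linarith)).symm
        _ ≤ Real.exp j := Real.exp_le_exp.2 h1
    have hsub : {x : EuclideanSpace ℝ (Fin 3) | 1 < ‖x‖ ∧ ‖x‖ < R} ⊆
        {x : EuclideanSpace ℝ (Fin 3) | 1 < ‖x‖ ∧ ‖x‖ < Real.exp j} := fun x hx =>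
      ⟨hx.1, lt_of_lt_of_le hx.2 hjR⟩
    have hjle : (j : ℝ) ≤ 1 + Real.log R := by
      have := Nat.ceil_lt_add_one hlog
      rw [← hj] at this
      linarith
    calc ∫⁻ x in {x : EuclideanSpace ℝ (Fin 3) | 1 < ‖x‖ ∧ ‖x‖ < R}, ENNReal.ofReal (‖g x‖ ^ 3)
        ≤ ∫⁻ x in {x : EuclideanSpace ℝ (Fin 3) | 1 < ‖x‖ ∧ ‖x‖ < Real.exp j}, ENNReal.ofReal (‖g x‖ ^ 3) :=
          lintegral_mono_set hsub
      _ ≤ ENNReal.ofReal (q * j) :=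
          lintegral_annulus_cube_le_of_weak hVc hgm hg2 hweak (by positivity) (hbudget j hjpos)
      _ ≤ ENNReal.ofReal (q * (1 + Real.log R)) :=
          ENNReal.ofReal_le_ofReal (mul_le_mul_of_nonneg_left hjle hq)

end Summit.NavierStokesRegularity.NavierStokesRegularity.Theorems.ThinCascade

end
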